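import Mathlib
import HarnessLib.Audit
import Summits.PneNP.PneNP.Theorems.PstarNorUnitNA
import Summits.PneNP.PneNP.Theorems.PstarChordBridgeForcing

/-!
# The NOR case of the bridge's forcing dichotomy is a CONS-T unit (glue `forced_chord_cases_sys` ⟶ `nor_unit_na`; ROUND-24, memo §9 R7/R8)

FRONTIER range-avoidance ladder, rung F-N3, ROUND 24 (cell `pnp-ideate`, planner memo `r24/CORE-BOUND-NOTES.md` §9 R1/R7/R8, §10 O5;
restricted-model proof complexity — nothing here bears on `P` versus `NP`).

`PstarChordBridgeForcing.forced_chord_cases_sys` (pnp-ideate-prover-2) turns a terminal core with bridge data `B` (single-read, constant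
reads, infeasible, chord-minimal in `e`) into the trichotomy (EQ) / (EXC) / (NOR) for the chord `e`, where (NOR) reads: for some `a b` with
`freePolar a b = 1`,

  `q(x) = (freePolar x b + β)(freePolar x a + α) + 1`  and  `Q_{D e}(x) + (γ_e + 1) = (freePolar x b + β + 1)·m₁(x) + (freePolar x a + α + 1)·m₂(x)`,

`q` the second constraint of the model (`free₂ + b₂`, polar form `freePolar = polar T₂ + polar (freeMon N G₂)`).  This file feeds that into
`PstarNorUnitNA.nor_unit_na`:

* `xor_not_mem_bdry_of_even` — an everywhere-even output family has no XOR variable on its boundary (the cycle condition for `D e + e`);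
* `nor_unit_of_bridge` — **in the NOR case the fundamental set `D e` is a CONS-T pair**: `D e = {j₁, j₂}` with disjoint AND pairs, the literal
  variables `{v : freePolar(e_v, b) ≠ 0 ∨ freePolar(e_v, a) ≠ 0}` are EXACTLY `{σ, τ}` with `σ ∈ andPair j₁`, `τ ∈ andPair j₂`, and some output
  of the join `T₂` or a private-free pendant of the second constraint has AND pair `{σ, τ}` (the NOR gadget).  The realisers of the literal
  products are read off `freePolar = sym(ℓ_b ⊗ ℓ_a)` (`polar_unique`) by `PstarPathRank.polar_basis`; those for pairs not AND-adjacent in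
  `D e` lie outside `D e + e`, which is all `nor_unit_na` asks.

So, modulo the single-read/constant-read/no-cross hypotheses of the bridge, every NOR-forced chord of a terminal core sits on ONE literal pair
`{σ, τ}` with its own `(σ,b)(τ,b′)` path and the NOR gadget `(σ,τ)` — the local shape of `PstarLitNorCore.LitNorStructure`.
-/

set_option linter.dupNamespace false -- `Summit.PneNP.PneNP.…`: summit = sub-problem name (D-0017 single-conjunct layout)

open Finset Module Literature.Computability.Complexity
open Summit.PneNP.PneNP.Theorems.PstarSALevel (varSet bdry BoundaryExpanding SimpleOverlap)
open Summit.PneNP.PneNP.Theorems.PstarGapLinearised (andPair andPair_subset_varSet)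
open Summit.PneNP.PneNP.Theorems.PstarChordEndgameTools (mem_andPair_iff)
open Summit.PneNP.PneNP.Theorems.PstarCentreFree (vars_mem_varSet)
open Summit.PneNP.PneNP.Theorems.PstarNorCoreTools (eq_of_mem_bdry vars_zero_ne_one)
open Summit.PneNP.PneNP.Theorems.PstarXorElimination (pdeg)
open Summit.PneNP.PneNP.Theorems.PstarCubeIdeals (IsAffineFn)
open Summit.PneNP.PneNP.Theorems.PstarQuadRank (rad)
open Summit.PneNP.PneNP.Theorems.PstarRankRigidityTwo (linPart symForm symForm_apply linPart_apply affine_mul_polar)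
open Summit.PneNP.PneNP.Theorems.PstarForcing (polar_unique)
open Summit.PneNP.PneNP.Theorems.PstarProductRank (qform polar)
open Summit.PneNP.PneNP.Theorems.PstarPathRank (AndAdj polar_basis)
open Summit.PneNP.PneNP.Theorems.PstarChordSystem (ChordSystem)
open Summit.PneNP.PneNP.Theorems.PstarChordBridgeTools (xpdeg)
open Summit.PneNP.PneNP.Theorems.PstarChordBridge (BridgeData sys sys_F sys_t)
open Summit.PneNP.PneNP.Theorems.PstarChordBridgeForcing (freeMon freePolar sys_q_add gam rank_four_of_wf)
open Summit.PneNP.PneNP.Theorems.PstarNorUnitCases (mem_of_andAdj)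
open Summit.PneNP.PneNP.Theorems.PstarNorUnitNA (nor_unit_na)

namespace Summit.PneNP.PneNP.Theorems.PstarNorUnitBridge

variable {n m : ℕ}

/-- **An everywhere-even output family has no XOR variable on its boundary** (a variable in an XOR slot of a member occurs in XOR slots an even,
positive number of times, hence in at least two members, the two XOR slots of one output being distinct). -/
theorem xor_not_mem_bdry_of_even (I : LocalMap 4 n m) (hI : I.IsPure xorAndPred) {E : Finset (Fin m)} (heven : ∀ w, Even (xpdeg I E w)) :
    ∀ j ∈ E, ∀ s : Fin 4, s.val < 2 → I.vars j s ∉ bdry I E := by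
  classical
  intro j hj s hs hb
  set w := I.vars j s with hw
  -- every output of `E` with `w` in an XOR slot reads `w`, hence is `j`
  have h0 : (E.filter fun j' => I.vars j' 0 = w) ⊆ {j} := by
    intro j' hj'
    rw [mem_filter] at hj'
    rw [mem_singleton]
    exact eq_of_mem_bdry I hj'.1 hj hb (hj'.2 ▸ vars_mem_varSet I j' 0) (hw ▸ vars_mem_varSet I j s)
  have h1 : (E.filter fun j' => I.vars j' 1 = w) ⊆ {j} := by
    intro j' hj'
    rw [mem_filter] at hj'
    rw [mem_singleton]
    exact eq_of_mem_bdry I hj'.1 hj hb (hj'.2 ▸ vars_mem_varSet I j' 1) (hw ▸ vars_mem_varSet I j s)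
  have hne := vars_zero_ne_one I hI j
  have hs' : s = 0 ∨ s = 1 := by
    rcases Nat.lt_or_ge s.val 1 with h | h
    · exact Or.inl (Fin.ext (by simp only [Fin.val_zero]; omega))
    · exact Or.inr (Fin.ext (by simp only [Fin.val_one]; omega))
  -- so `xpdeg E w = 1`, contradicting evenness
  have hodd : xpdeg I E w = 1 := by
    unfold PstarChordBridgeTools.xpdeg pdeg
    rcases hs' with rfl | rfl
    · have e0 : (E.filter fun j' => I.vars j' 0 = w) = {j} :=
        Subset.antisymm h0 (singleton_subset_iff.2 (mem_filter.2 ⟨hj, rfl⟩))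
      have e1 : (E.filter fun j' => I.vars j' 1 = w) = ∅ := by
        refine eq_empty_of_forall_notMem fun j' hj' => ?_
        have := h1 hj'
        rw [mem_singleton] at this
        subst this
        exact hne ((mem_filter.1 hj').2.trans hw).symm
      rw [e0, e1, card_singleton, card_empty]
    · have e1 : (E.filter fun j' => I.vars j' 1 = w) = {j} :=
        Subset.antisymm h1 (singleton_subset_iff.2 (mem_filter.2 ⟨hj, rfl⟩))
      have e0 : (E.filter fun j' => I.vars j' 0 = w) = ∅ := by
        refine eq_empty_of_forall_notMem fun j' hj' => ?_
        have := h0 hj'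
        rw [mem_singleton] at this
        subst this
        exact hne ((mem_filter.1 hj').2.trans hw)
      rw [e0, e1, card_singleton, card_empty]
  have := heven w
  rw [hodd] at this
  exact Nat.not_even_one this

/-- **The NOR case of the bridge is a CONS-T unit.**  See the module docstring.  Hypotheses beyond the bridge data: `#(J₀ ∪ G₂) ≤ r` (the
folded pendants are outputs of the ambient minimal set), `e ∉ G₂` (pendants are not core outputs), and the NOR disjunct of
`forced_chord_cases_sys` for the chord `e` verbatim (constants `β, α` arbitrary). -/
theorem nor_unit_of_bridge (I : LocalMap 4 n m) (hI : I.IsPure xorAndPred) (hS : SimpleOverlap I) {r : ℕ} (hB : BoundaryExpanding r I)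
    {B : BridgeData n m} (hW : B.WF I) (hr : (B.J₀ ∪ B.G₂).card ≤ r) {e : Fin m} (he : e ∈ B.N) (heG : e ∉ B.G₂)
    {a b : Fin n → ZMod 2} {β α : ZMod 2}
    (hq : ∀ x, ((sys I B).F x).2 + (sys I B).t.2 = (freePolar I B.N B.T₂ B.G₂ x b + β) * (freePolar I B.N B.T₂ B.G₂ x a + α) + 1)
    {m₁ m₂ : (Fin n → ZMod 2) → ZMod 2} (hm₁ : IsAffineFn m₁) (hm₂ : IsAffineFn m₂)
    (hQ : ∀ x, qform (B.D e) (fun j => I.vars j 2) (fun j => I.vars j 3) x + (gam B e + 1) =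
      (freePolar I B.N B.T₂ B.G₂ x b + β + 1) * m₁ x + (freePolar I B.N B.T₂ B.G₂ x a + α + 1) * m₂ x) :
    ∃ j₁ j₂ : Fin m, ∃ σ τ : Fin n, j₁ ≠ j₂ ∧ B.D e = {j₁, j₂} ∧ Disjoint (andPair I j₁) (andPair I j₂) ∧ σ ∈ andPair I j₁ ∧ τ ∈ andPair I j₂ ∧
      (∀ v : Fin n, (freePolar I B.N B.T₂ B.G₂ (Pi.single v 1) b ≠ 0 ∨ freePolar I B.N B.T₂ B.G₂ (Pi.single v 1) a ≠ 0) ↔ (v = σ ∨ v = τ)) ∧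
      ∃ g ∈ B.T₂ ∪ freeMon I B.N B.G₂, σ ∈ andPair I g ∧ τ ∈ andPair I g := by
  classical
  set fP := freePolar I B.N B.T₂ B.G₂ with hfP
  -- the two affine literal factors `μ₁ = λ_b + 1`, `μ₂ = λ_a + 1`, and the factors `λ_b, λ_a` of `q`
  have haff : ∀ (y : Fin n → ZMod 2) (k : ZMod 2), IsAffineFn (fun x => fP x y + k) := by
    intro y k x w
    show fP (x + w) y + k = fP x y + k + (fP w y + k) + (fP 0 y + k)
    rw [map_add, LinearMap.add_apply, map_zero, LinearMap.zero_apply, zero_add]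
    generalize fP x y = s; generalize fP w y = t
    revert s t k; decide
  have hμ₁ : IsAffineFn (fun x => fP x b + (β + 1)) := haff b (β + 1)
  have hμ₂ : IsAffineFn (fun x => fP x a + (α + 1)) := haff a (α + 1)
  have hlb : IsAffineFn (fun x => fP x b + β) := haff b β
  have hla : IsAffineFn (fun x => fP x a + α) := haff a α
  -- their linear parts are `fP · b`, `fP · a`
  have e3 : ∀ s k : ZMod 2, s + k + k = s := by decide
  have lin : ∀ {y : Fin n → ZMod 2} {k : ZMod 2} (h : IsAffineFn (fun x => fP x y + k)) (x : Fin n → ZMod 2), linPart h x = fP x y := by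
    intro y k h x
    rw [linPart_apply]
    show fP x y + k + (fP 0 y + k) = fP x y
    rw [map_zero, LinearMap.zero_apply, zero_add]
    exact e3 _ _
  have hQ' : ∀ x, qform (B.D e) (fun j => I.vars j 2) (fun j => I.vars j 3) x + (gam B e + 1) =
      (fun x => fP x b + (β + 1)) x * m₁ x + (fun x => fP x a + (α + 1)) x * m₂ x := by
    intro x; rw [hQ x]; simp only [add_assoc]
  -- `freePolar = sym(ℓ_b ⊗ ℓ_a)`: both are polar forms of `q`
  have hpol : fP = symForm (linPart hlb) (linPart hla) := by
    refine polar_unique (Q := fun x => ((sys I B).F x).2 + (sys I B).t.2) (sys_q_add I B) fun x w => ?_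
    show ((sys I B).F (x + w)).2 + (sys I B).t.2 = _
    rw [hq, hq x, hq w, hq 0, affine_mul_polar hlb hla]
    generalize (fP x b + β) * (fP x a + α) = s; generalize (fP w b + β) * (fP w a + α) = s'
    generalize (fP 0 b + β) * (fP 0 a + α) = s₀; generalize symForm (linPart hlb) (linPart hla) x w = t
    revert s s' s₀ t; decide
  -- the gadget set: realisers of the literal products outside `D e + e`
  set G : Finset (Fin m) := (B.T₂ ∪ freeMon I B.N B.G₂).filter fun g => g ∉ insert e (B.D e) with hGdef
  have heD : e ∉ B.D e := fun h => (mem_sdiff.1 (hW.hD e he h)).2 he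
  have hGd : Disjoint G (insert e (B.D e)) := by
    rw [Finset.disjoint_left]
    intro g hg
    exact (mem_filter.1 hg).2
  have hsub : insert e (B.D e) ∪ G ⊆ B.J₀ ∪ B.G₂ := by
    intro g hg
    rcases mem_union.1 hg with hg | hg
    · rcases mem_insert.1 hg with rfl | hg
      · exact mem_union_left _ (hW.hN he)
      · exact mem_union_left _ (mem_sdiff.1 (hW.hD e he hg)).1
    · have hg' := (mem_filter.1 hg).1
      rcases mem_union.1 hg' with hg' | hg'
      · exact mem_union_left _ (mem_sdiff.1 (hW.hT₂ hg')).1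
      · exact mem_union_right _ (mem_filter.1 hg').1
  have hr' : (insert e (B.D e) ∪ G).card ≤ r := (card_le_card hsub).trans hr
  have hcyc := xor_not_mem_bdry_of_even I hI (hW.hDeven e he)
  have hrank := rank_four_of_wf I hI hS hB hW ((card_le_card subset_union_left).trans hr) he
  -- the gadget hypothesis for pairs not AND-adjacent in `D e`
  have hK : ∀ v w : Fin n, v ≠ w → ¬ AndAdj I (B.D e) v w →
      linPart hμ₁ (Pi.single v 1) * linPart hμ₂ (Pi.single w 1) + linPart hμ₁ (Pi.single w 1) * linPart hμ₂ (Pi.single v 1) = 1 →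
        ∃ g ∈ G, v ∈ andPair I g ∧ w ∈ andPair I g := by
    intro v w hvw hna hdet
    rw [lin hμ₁, lin hμ₁, lin hμ₂, lin hμ₂] at hdet
    -- this is `freePolar (e_v) (e_w)`
    have hval : fP (Pi.single v 1) (Pi.single w 1) = 1 := by
      rw [hpol, symForm_apply, lin hlb, lin hlb, lin hla, lin hla]
      exact hdet
    rw [hfP] at hval
    unfold PstarChordBridgeForcing.freePolar at hval
    rw [LinearMap.add_apply, LinearMap.add_apply, polar_basis I hI hS, polar_basis I hI hS] at hval
    -- exactly one of the two indicators is `1`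
    have key : AndAdj I B.T₂ v w ∨ AndAdj I (freeMon I B.N B.G₂) v w := by
      by_contra hno
      obtain ⟨h₁, h₂⟩ := not_or.1 hno
      rw [if_neg h₁, if_neg h₂, add_zero] at hval
      exact zero_ne_one hval
    have hreal : ∃ g ∈ B.T₂ ∪ freeMon I B.N B.G₂, v ∈ andPair I g ∧ w ∈ andPair I g := by
      rcases key with h | h
      · obtain ⟨g, hg, hm⟩ := mem_of_andAdj h
        exact ⟨g, mem_union_left _ hg, hm⟩
      · obtain ⟨g, hg, hm⟩ := mem_of_andAdj h
        exact ⟨g, mem_union_right _ hg, hm⟩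
    obtain ⟨g, hg, hvg, hwg⟩ := hreal
    refine ⟨g, mem_filter.2 ⟨hg, fun hge => ?_⟩, hvg, hwg⟩
    rcases mem_insert.1 hge with rfl | hgD
    · -- `e` is neither a join output nor a pendant
      rcases mem_union.1 hg with h | h
      · exact (mem_sdiff.1 (hW.hT₂ h)).2 he
      · exact heG (mem_filter.1 h).1
    · -- a realiser inside `D e` would make `v, w` AND-adjacent there
      refine hna ?_
      rw [mem_andPair_iff] at hvg hwg
      rcases hvg with rfl | rfl <;> rcases hwg with rfl | rfl
      · exact absurd rfl hvw
      · exact ⟨g, hgD, Or.inl ⟨rfl, rfl⟩⟩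
      · exact ⟨g, hgD, Or.inr ⟨rfl, rfl⟩⟩
      · exact absurd rfl hvw
  obtain ⟨j₁, j₂, σ, τ, hne, hDe, hdisj, hσ, hτ, hlit, g, hg, hσg, hτg⟩ :=
    nor_unit_na hI hS hB heD hGd hr' hcyc hμ₁ hμ₂ hm₁ hm₂ hQ' hK hrank
  refine ⟨j₁, j₂, σ, τ, hne, hDe, hdisj, hσ, hτ, fun v => ?_, g, (mem_filter.1 hg).1, hσg, hτg⟩
  rw [← hlit v, lin hμ₁, lin hμ₂]

/-! ## The literal pair depends only on `q` -/

open Summit.PneNP.PneNP.Theorems.PstarPathRank (polar_self_and polar_symm_and)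

/-- **Literals are the shift-sensitive coordinates of `q`.**  If `q(x) = (B x b + β)(B x a + α) + 1` for a symmetric alternating form `B`
with `B a b = 1`, then `B d b ≠ 0 ∨ B d a ≠ 0 ↔ ∃ x, q (x + d) ≠ q x`.  (`⇐`: a direction in `ker B(·,b) ∩ ker B(·,a)` fixes both factors;
`⇒`: compare `q` at `0, a, b` and their `d`-translates.) -/
theorem lit_iff_shift {M : Type*} [AddCommGroup M] [Module (ZMod 2) M] (Bf : LinearMap.BilinForm (ZMod 2) M) {q : M → ZMod 2}
    {a b : M} {β α : ZMod 2} (hq : ∀ x, q x = (Bf x b + β) * (Bf x a + α) + 1) (hab : Bf a b = 1) (hba : Bf b a = 1)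
    (haa : Bf a a = 0) (hbb : Bf b b = 0) (d : M) : (Bf d b ≠ 0 ∨ Bf d a ≠ 0) ↔ ∃ x, q (x + d) ≠ q x := by
  have hshift : ∀ x, q (x + d) = (Bf x b + Bf d b + β) * (Bf x a + Bf d a + α) + 1 := by
    intro x; rw [hq, map_add, LinearMap.add_apply, LinearMap.add_apply]
  constructor
  · intro h
    by_contra hall
    push Not at hall
    have h0 := hall 0
    have ha := hall a
    have hb := hall b
    rw [hshift, hq] at h0 ha hb
    rw [map_zero, LinearMap.zero_apply, LinearMap.zero_apply] at h0
    rw [hab, haa] at ha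
    rw [hba, hbb] at hb
    clear hall hshift hq
    revert h h0 ha hb
    generalize Bf d b = u; generalize Bf d a = v
    revert u v α β; decide
  · rintro ⟨x, hx⟩
    by_contra h
    obtain ⟨hu, hv⟩ := not_or.1 h
    push Not at hu hv
    apply hx
    rw [hshift, hq, hu, hv, add_zero, add_zero]

/-- **The literal pair of `nor_unit_of_bridge` is chord-independent**: in the NOR case, `v` is a literal iff the second constraint
`q = free₂ + b₂` of the model is not invariant under `x ↦ x + e_v` — a condition on `q` alone (same for every chord of the core). -/
theorem lit_iff_of_bridge (I : LocalMap 4 n m) (B : BridgeData n m) {a b : Fin n → ZMod 2} {β α : ZMod 2}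
    (hab : freePolar I B.N B.T₂ B.G₂ a b = 1)
    (hq : ∀ x, ((sys I B).F x).2 + (sys I B).t.2 = (freePolar I B.N B.T₂ B.G₂ x b + β) * (freePolar I B.N B.T₂ B.G₂ x a + α) + 1)
    (v : Fin n) :
    (freePolar I B.N B.T₂ B.G₂ (Pi.single v 1) b ≠ 0 ∨ freePolar I B.N B.T₂ B.G₂ (Pi.single v 1) a ≠ 0) ↔
      ∃ x, ((sys I B).F (x + Pi.single v 1)).2 + (sys I B).t.2 ≠ ((sys I B).F x).2 + (sys I B).t.2 := by
  have hsymm : ∀ x y : Fin n → ZMod 2, freePolar I B.N B.T₂ B.G₂ x y = freePolar I B.N B.T₂ B.G₂ y x := by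
    intro x y
    unfold PstarChordBridgeForcing.freePolar
    rw [LinearMap.add_apply, LinearMap.add_apply, LinearMap.add_apply, LinearMap.add_apply, polar_symm_and I B.T₂ x y,
      polar_symm_and I (freeMon I B.N B.G₂) x y]
  have hself : ∀ x : Fin n → ZMod 2, freePolar I B.N B.T₂ B.G₂ x x = 0 := by
    intro x
    unfold PstarChordBridgeForcing.freePolar
    rw [LinearMap.add_apply, LinearMap.add_apply, polar_self_and, polar_self_and, add_zero]
  exact lit_iff_shift (freePolar I B.N B.T₂ B.G₂) (q := fun x => ((sys I B).F x).2 + (sys I B).t.2) hq hab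
    (by rw [hsymm]; exact hab) (hself a) (hself b) (Pi.single v 1)

end Summit.PneNP.PneNP.Theorems.PstarNorUnitBridge
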